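import Literature.AlgebraicGeometry.Liu2021.AdmissibleElement
import Literature.NumberTheory.Automorphic.Liu2021.Def411WeilCarriers
import HarnessLib

/-!
# [Liu2021, Def. 4.12]: rescaling a `μ`-admissible element by a totally positive scalar of `E⁺`

Topic `NumberTheory/Automorphic/Liu2021`; namespaces `Literature.AlgebraicGeometry.Liu2021` (the element `e` of Def. 4.12,
`IsAdmissibleElement`) and `Literature.NumberTheory.Automorphic.Liu2021.Def411WeilCarriers` (the collections `Eps ∋ epsOf e`,
`locF`).  THEOREMS ONLY (no definition, no named fact, no instance).

[Liu2021, Def. 4.12 (FJcycle.tex l. 2102–2108)]: «`ε` is `μ`-admissible if there exists some `e ∈ E^{×−}` such that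
`ε_v = e Nm_{E_v/F_v} E_v^×` for every nonarchimedean place `v` of `F`, and `τ'(e)` has negative imaginary part for every
`τ' ∈ Φ_μ`.»  Both clauses are stable under `e ↦ t·e` for `t ∈ F^×` TOTALLY POSITIVE (`φ(t) > 0` for every real embedding
`φ : F →+* ℝ`, `F = E⁺` totally real): `t·e ∈ E^{×−}`, `Im τ'(t e) = τ'(t)·Im τ'(e) < 0`, and the collection of `t·e` is
`(t·ε_v)_v`, i.e. `epsOf (t e) = locF t · epsOf e` in the tree's `δ`-normalised currency (`Def411WeilCarriers`).  This is the
RE-INDEXING step (P5b) of the cell hodgecm-mathlib's road to [Liu2021, Thm. 4.18 (3)] (row III-11, A-p19's memo v2): after a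
`p`-adic unit `κ` has been replaced by a totally positive global `t` of the same local square class
(`NumberFields/TotallyPositivePrescribedSquareClass.lean`), the rescaled index `(locF t · ε, χ′)` is again `μ`-ADMISSIBLE, so
[App. D Lem. D.1 (3)] applies to it inside the SAME `μ`-indexed family.  HC_CM is proved only modulo the 7 printed citations until
rung 0 closes; this file discharges none of them.

## References
* [Liu2021] Y. Liu, *Fourier–Jacobi cycles and arithmetic relative trace formula*, Camb. J. Math. 9 (2021) = arXiv:2102.11518:
  Def. 4.12 (l. 2102–2108); Thm. 4.18 (3) proof (l. 2272–2289).
-/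

noncomputable section

open NumberField NumberField.InfinitePlace NumberField.ComplexEmbedding
open scoped ComplexConjugate

/-! ## §1 The element: `e ↦ t·e` preserves `μ`-admissibility for `t ∈ E⁺` totally positive -/

namespace Literature.AlgebraicGeometry.Liu2021

variable {E : Type} [Field E] [NumberField E] [IsCMField E]

omit [NumberField E] [IsCMField E] in
/-- For `t ∈ E⁺` and `τ' : E →+* ℂ`, `τ'(t)` is REAL, and equals `ψ(t)` for the real embedding `ψ : E⁺ →+* ℝ` under `τ'`.
[cite: Liu2021, §4 preamble (l. 1880–1890: `E/F` CM, `F = E⁺` totally real)] -/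
theorem exists_embedding_apply_algebraMap_maximalRealSubfield (τ' : E →+* ℂ) :
    ∃ ψ : maximalRealSubfield E →+* ℝ, ∀ t : maximalRealSubfield E, τ' (algebraMap (maximalRealSubfield E) E t) = (ψ t : ℂ) := by
  have hreal : ComplexEmbedding.IsReal (τ'.comp (algebraMap (maximalRealSubfield E) E)) := by
    rw [ComplexEmbedding.isReal_iff]
    ext t
    rw [ComplexEmbedding.conjugate_coe_eq, RingHom.comp_apply]
    exact (mem_maximalRealSubfield_iff (t : E)).1 t.2 τ'
  exact ⟨hreal.embedding, fun t => (ComplexEmbedding.IsReal.coe_embedding_apply hreal t).symm⟩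

/-- **[Liu2021, Def. 4.12] under rescaling**: if `e` is `μ`-admissible for `Φ` (`e ≠ 0`, `ē = −e`, `Im τ'(e) < 0` on `Φ`) and
`t ∈ E⁺` is totally positive, then `t·e` is `μ`-admissible for `Φ` (`\overline{t e} = t·(−e)`, `Im τ'(t e) = τ'(t)·Im τ'(e) < 0`).
[cite: Liu2021, Def. 4.12 (FJcycle.tex l. 2102–2108)] -/
theorem IsAdmissibleElement.algebraMap_mul {Φ : Set (E →+* ℂ)} {e : E} (he : IsAdmissibleElement E Φ e)
    (t : maximalRealSubfield E) (ht : ∀ ψ : maximalRealSubfield E →+* ℝ, 0 < ψ t) :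
    IsAdmissibleElement E Φ (algebraMap (maximalRealSubfield E) E t * e) := by
  obtain ⟨he0, hec, heim⟩ := he
  -- `t ≠ 0`: read at any real embedding (the maximal real subfield is totally real and has an infinite place)
  obtain ⟨w₀⟩ : Nonempty (InfinitePlace (maximalRealSubfield E)) := inferInstance
  have ht0 : t ≠ 0 := by
    rintro rfl
    have h := ht (InfinitePlace.embedding_of_isReal (IsTotallyReal.isReal w₀))
    rw [map_zero] at h
    exact lt_irrefl _ h
  refine ⟨mul_ne_zero ((map_ne_zero _).2 ht0) he0, ?_, fun τ' hτ' => ?_⟩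
  · rw [map_mul, hec, AlgEquiv.commutes, mul_neg]
  · obtain ⟨ψ, hψ⟩ := exists_embedding_apply_algebraMap_maximalRealSubfield τ'
    rw [map_mul, hψ t, Complex.im_ofReal_mul]
    exact mul_neg_of_pos_of_neg (ht ψ) (heim τ' hτ')

end Literature.AlgebraicGeometry.Liu2021

/-! ## §2 The collection: `epsOf (t·e) = locF t · epsOf e` -/

namespace Literature.NumberTheory.Automorphic.Liu2021.Def411WeilCarriers

section General

variable (F : Type) [Field F] [NumberField F] (d : F) (E : Type) [Field E] [Algebra F E] (δ : E)

/-- `fPart` is `F`-linear: `½ Tr_{E/F}(t x) = t · ½ Tr_{E/F}(x)` for `t ∈ F`. [cite: Liu2021, Def. 4.12 (l. 2105)] -/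
theorem fPart_algebraMap_mul (t : F) (x : E) : fPart F E (algebraMap F E t * x) = t * fPart F E x := by
  rw [fPart, fPart, ← Algebra.smul_def, LinearMap.map_smul, smul_eq_mul]
  ring

/-- **The collection of `t·e` is `t` times the collection of `e`** — `epsOf (t e) = locF t · epsOf e` for `t ∈ F^×`, whenever
`e` is off the junk locus of `epsOf` (`½Tr(e/δ) ≠ 0`; this holds for every `e ∈ E^{×−}`, see
`epsOf_algebraMap_mul_eq_locF_mul_of_complexConj_eq_neg`): «`ε_v = e·Nm E_v^×`» is multiplicative in `e`.
[cite: Liu2021, Def. 4.12 (FJcycle.tex l. 2105)] -/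
theorem epsOf_algebraMap_mul_eq_locF_mul (t : Fˣ) {e : E} (he : fPart F E (e * δ⁻¹) ≠ 0) :
    epsOf F d E δ (algebraMap F E t * e) = locF F d t * epsOf F d E δ e := by
  classical
  have h1 : fPart F E (algebraMap F E t * e * δ⁻¹) = t * fPart F E (e * δ⁻¹) := by
    rw [mul_assoc, fPart_algebraMap_mul]
  have h2 : fPart F E (algebraMap F E t * e * δ⁻¹) ≠ 0 := by
    rw [h1]
    exact mul_ne_zero t.ne_zero he
  unfold epsOf
  rw [dif_neg h2, dif_neg he, ← map_mul]
  congr 1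
  exact Units.ext (by rw [Units.val_mk0, Units.val_mul, Units.val_mk0, h1])

/-- The collection of `(t a)·δ` is `locF (t a) = locF t · locF a` (the case `e = a δ` of the previous lemma, junk-free).
[cite: Liu2021, Def. 4.12 (FJcycle.tex l. 2105)] -/
theorem epsOf_algebraMap_mul_algebraMap_mul [Algebra.IsQuadraticExtension F E] (hδ : δ ≠ 0) (t a : Fˣ) :
    epsOf F d E δ (algebraMap F E t * (algebraMap F E a * δ)) = locF F d t * locF F d a := by
  rw [← mul_assoc, ← map_mul, ← Units.val_mul, epsOf_algebraMap_mul F d E δ hδ, map_mul]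

end General

section CM

variable {K : Type} [Field K] [NumberField K] [IsCMField K]

/-- In a CM field, a non-zero purely imaginary `e` divided by a purely imaginary `δ ≠ 0` lies in `K⁺` and is non-zero, so `e` is OFF
the junk locus of `epsOf … δ`: `½Tr(e/δ) = e/δ ≠ 0`. [cite: Liu2021, Def. 4.12 (l. 2105); §4 preamble (l. 1884: `E^− = {e : e + e^c = 0}`)] -/
theorem fPart_mul_inv_ne_zero_of_complexConj_eq_neg {δ e : K} (hδ : IsCMField.complexConj K δ = -δ) (hδ0 : δ ≠ 0)
    (he : IsCMField.complexConj K e = -e) (he0 : e ≠ 0) :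
    fPart (maximalRealSubfield K) K (e * δ⁻¹) ≠ 0 := by
  have hmem : e * δ⁻¹ ∈ maximalRealSubfield K := by
    rw [← IsCMField.complexConj_eq_self_iff, map_mul, map_inv₀, hδ, he, inv_neg, neg_mul_neg]
  have hr : e * δ⁻¹ = algebraMap (maximalRealSubfield K) K ⟨e * δ⁻¹, hmem⟩ := rfl
  rw [hr, fPart_algebraMap]
  exact fun h => mul_ne_zero he0 (inv_ne_zero hδ0) (by rw [hr, h, map_zero])

/-- **`epsOf (t e) = locF t · epsOf e` for `e ∈ E^{×−}`** (CM field `K = E`, `F = E⁺ = maximalRealSubfield K`, the lane's purely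
imaginary `δ ≠ 0`). [cite: Liu2021, Def. 4.12 (FJcycle.tex l. 2105)] -/
theorem epsOf_algebraMap_mul_eq_locF_mul_of_complexConj_eq_neg (d : maximalRealSubfield K) {δ e : K}
    (hδ : IsCMField.complexConj K δ = -δ) (hδ0 : δ ≠ 0) (he : IsCMField.complexConj K e = -e) (he0 : e ≠ 0)
    (t : (maximalRealSubfield K)ˣ) :
    epsOf (maximalRealSubfield K) d K δ (algebraMap (maximalRealSubfield K) K t * e) =
      locF (maximalRealSubfield K) d t * epsOf (maximalRealSubfield K) d K δ e :=
  epsOf_algebraMap_mul_eq_locF_mul (maximalRealSubfield K) d K δ t (fPart_mul_inv_ne_zero_of_complexConj_eq_neg hδ hδ0 he he0)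

/-- **RE-INDEXING ([Liu2021, Def. 4.12] + Thm. 4.18 (3) proof)**: if `ε = epsOf e` with `e` `μ`-admissible for `Φ` and `t ∈ (E⁺)^×` is
totally positive, then `locF t · ε` is again the collection of a `μ`-admissible element, namely `t·e` — so the rescaled index stays in
the `μ`-admissible index set of Thm. 4.18. [cite: Liu2021, Def. 4.12 (FJcycle.tex l. 2102–2108); Thm. 4.18 (3) proof (l. 2272–2289)] -/
theorem exists_isAdmissibleElement_epsOf_eq_locF_mul (d : maximalRealSubfield K) {δ : K}
    (hδ : IsCMField.complexConj K δ = -δ) (hδ0 : δ ≠ 0) {Φ : Set (K →+* ℂ)} {e : K}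
    (he : Literature.AlgebraicGeometry.Liu2021.IsAdmissibleElement K Φ e) (t : (maximalRealSubfield K)ˣ)
    (ht : ∀ ψ : maximalRealSubfield K →+* ℝ, 0 < ψ (t : maximalRealSubfield K)) :
    ∃ e' : K, Literature.AlgebraicGeometry.Liu2021.IsAdmissibleElement K Φ e' ∧
      epsOf (maximalRealSubfield K) d K δ e' = locF (maximalRealSubfield K) d t * epsOf (maximalRealSubfield K) d K δ e :=
  ⟨_, he.algebraMap_mul (t : maximalRealSubfield K) ht,
    epsOf_algebraMap_mul_eq_locF_mul_of_complexConj_eq_neg d hδ hδ0 he.2.1 he.1 t⟩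

end CM

end Literature.NumberTheory.Automorphic.Liu2021.Def411WeilCarriers

end
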